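import Summits.Parity.BatemanHorn.Theorems.AlmostPrimeZerosDiscMajorantLogRealAxisFixedInterval
import HarnessLib

/-!
# Crux `DiscMajorantLog` (stmt-Parity-17114), line `Sketch`: the parity-free core near the centre,
for EVERY Bateman–Horn system (registered stub `stub_nearCentre`)

Crux `Summit.Parity.BatemanHorn.Theses.AlmostPrimeZeros.DiscMajorantLog` asks
`‖S_x(z)‖ ≤ A·x·(log x)^{k(Re z−1)}·e^{C‖z−1‖log(‖z−1‖+2)}` on the growing disc `‖z − 1‖ ≤ 3 log log x`,
`S_x(z) = Σ_{0≤n≤x} z^{s_f(n)}`.  Off the positive real axis every proof needs cancellation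
(`Negative/StrengtheningsRefuted.not_discMajorantLog_abs`), EXCEPT in a neighbourhood of the centre
`z = 1` that shrinks like `(log log x)^{−1/2}`: by the triangle inequality and the landed real segment
`stub_realAxisFixedInterval` (all systems, Nair–Tenenbaum light),

  `‖S_x(z)‖ ≤ S_x(‖z‖) ≤ A·x·(log x)^{k(‖z‖−1)} = A·x·(log x)^{k(Re z−1)}·(log x)^{k(‖z‖ − Re z)}`,

and `‖z‖ − Re z = (Im z)²/(‖z‖ + Re z) ≤ ‖z − 1‖²` for `‖z − 1‖ ≤ 1/2`.  So the crux holds for ALL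
systems with the explicit loss factor `exp(k‖z−1‖² log log x)` on `‖z − 1‖ ≤ 1/2` (`stub_nearCentre`),
in particular VERBATIM (budget constant `C = 0`) on the shrinking disc `‖z − 1‖² log log x ≤ 1`
(`discMajorantLog_shrinkingDisc`).  This is the "free cusp" of the k1 atlas (§2.2: `|arg z| ≲ L^{−1/2}`,
CLT scale); everything the three open composition stubs ask lies outside it.

References: M. Nair, G. Tenenbaum, Acta Math. 180 (1998), Thm 1 (through `stub_realAxisFixedInterval`).
-/

noncomputable section

namespace Summit.Parity.BatemanHorn.Cruxes.DiscMajorantLog.Sketch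

open scoped BigOperators

namespace NearCentre

/-- For `‖z − 1‖ ≤ 1/2`: `‖z‖ − Re z ≤ ‖z − 1‖²` (indeed `(‖z‖ − Re z)(‖z‖ + Re z) = (Im z)²`,
`‖z‖ + Re z ≥ 2 Re z ≥ 1` and `|Im z| = |Im (z − 1)| ≤ ‖z − 1‖`). -/
theorem norm_sub_re_le_sq {z : ℂ} (hz : ‖z - 1‖ ≤ 1 / 2) : ‖z‖ - z.re ≤ ‖z - 1‖ ^ 2 := by
  have hre : 1 / 2 ≤ z.re := by
    have h1 : |(z - 1).re| ≤ ‖z - 1‖ := Complex.abs_re_le_norm _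
    have h2 : (z - 1).re = z.re - 1 := by simp
    rw [h2] at h1
    linarith [neg_abs_le (z.re - 1)]
  have him : |z.im| ≤ ‖z - 1‖ := by
    have h1 : |(z - 1).im| ≤ ‖z - 1‖ := Complex.abs_im_le_norm _
    simpa using h1
  have hnz : z.re ≤ ‖z‖ := Complex.re_le_norm z
  have hsq : ‖z‖ ^ 2 = z.re ^ 2 + z.im ^ 2 := by
    rw [Complex.sq_norm, Complex.normSq_apply]; ring
  have hsum : 1 ≤ ‖z‖ + z.re := by linarith
  have hprod : (‖z‖ - z.re) * (‖z‖ + z.re) = z.im ^ 2 := by nlinarith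
  have him2 : z.im ^ 2 ≤ ‖z - 1‖ ^ 2 := by
    have := sq_abs z.im
    nlinarith [abs_nonneg z.im, norm_nonneg (z - 1)]
  nlinarith

/-- The triangle inequality for the statistic: `‖Σ_n z^{e n}‖ ≤ Σ_n ‖z‖^{e n}`. -/
theorem norm_sum_pow_le_sum_norm_pow (z : ℂ) (s : Finset ℕ) (e : ℕ → ℕ) :
    ‖∑ n ∈ s, z ^ (e n)‖ ≤ ∑ n ∈ s, ‖z‖ ^ (e n) :=
  (norm_sum_le _ _).trans (le_of_eq (Finset.sum_congr rfl fun n _ => norm_pow z (e n)))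

/-- Splitting the harmonic factor: for `L > 0`,
`L^{k(t−1)} = L^{k(σ−1)} · exp(k (t − σ) log L)`. -/
theorem rpow_split {L : ℝ} (hL : 0 < L) (k t σ : ℝ) :
    L ^ (k * (t - 1)) = L ^ (k * (σ - 1)) * Real.exp (k * (t - σ) * Real.log L) := by
  rw [Real.rpow_def_of_pos hL, Real.rpow_def_of_pos hL, ← Real.exp_add]
  congr 1; ring

end NearCentre

open NearCentre in
/-- **Registered stub `stub_nearCentre` (the parity-free core, ALL systems).**  For every Bateman–Horn
system there are `A, x₀` such that for all `x ≥ x₀` and all `‖z − 1‖ ≤ 1/2`: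
`‖S_x(z)‖ ≤ A·x·(log x)^{k(Re z−1)}·exp(k‖z−1‖² log log x)`.
Proof: triangle inequality, `stub_realAxisFixedInterval` at `t = ‖z‖ ∈ [1/2, 3/2]` (`T = 2`), and
`‖z‖ − Re z ≤ ‖z − 1‖²`. [cite: NairTenenbaum1998, Theorem 1] -/
theorem stub_nearCentre :
    ∀ (k : ℕ) (f : Fin k → Polynomial ℤ), Literature.NumberTheory.Sieve.IsBatemanHornSystem f →
      ∃ A : ℝ, ∃ x₀ : ℕ, ∀ x : ℕ, x₀ ≤ x → ∀ z : ℂ, ‖z - 1‖ ≤ 1 / 2 →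
        ‖(∑ n ∈ Finset.range (x + 1), (z : ℂ) ^ (∑ i, (((f i).eval (n : ℤ)).toNat.factorization.sum fun _ v => min v 2)))‖ ≤
          A * (x : ℝ) * (Real.log (x : ℝ)) ^ ((k : ℝ) * ((z : ℂ).re - 1)) *
            Real.exp ((k : ℝ) * ‖z - 1‖ ^ 2 * Real.log (Real.log (x : ℝ))) := by
  intro k f hf
  obtain ⟨A, x₁, hA⟩ := stub_realAxisFixedInterval k f hf 2 (by norm_num)
  refine ⟨max A 0, max x₁ 3, fun x hx z hz => ?_⟩
  have hx₁ : x₁ ≤ x := (le_max_left _ _).trans hx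
  have hx3 : (3 : ℝ) ≤ x := by exact_mod_cast (le_max_right _ _).trans hx
  set N : ℕ → ℕ := fun n => ∑ i, (((f i).eval (n : ℤ)).toNat.factorization.sum fun _ v => min v 2)
    with hNdef
  set t : ℝ := ‖z‖ with htdef
  -- `t ∈ [1/2, 3/2]`
  have ht : 1 / 2 ≤ t ∧ t ≤ 3 / 2 := by
    have h1 : ‖(1 : ℂ)‖ - ‖z‖ ≤ ‖1 - z‖ := norm_sub_norm_le 1 z
    have h2 : ‖z‖ - ‖(1 : ℂ)‖ ≤ ‖z - 1‖ := norm_sub_norm_le z 1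
    rw [norm_one, norm_sub_rev] at h1
    rw [norm_one] at h2
    rw [htdef]
    constructor <;> linarith
  have htpos : 0 < t := by linarith [ht.1]
  -- log x ≥ 1, log log x ≥ 0
  have hlogx : 1 < Real.log (x : ℝ) := by
    rw [Real.lt_log_iff_exp_lt (by linarith)]
    exact Real.exp_one_lt_d9.trans_le (by norm_num; linarith)
  have hL0 : 0 < Real.log (x : ℝ) := by linarith
  have hLL0 : 0 ≤ Real.log (Real.log (x : ℝ)) := Real.log_nonneg hlogx.le
  -- the real-axis bound at `t`
  have hreal := hA x hx₁ t htpos (by linarith [ht.2])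
  have htri : ‖∑ n ∈ Finset.range (x + 1), z ^ N n‖ ≤ ∑ n ∈ Finset.range (x + 1), t ^ N n :=
    norm_sum_pow_le_sum_norm_pow z _ N
  -- the harmonic factor
  have hsplit := rpow_split hL0 (k : ℝ) t z.re
  have hdiff : t - z.re ≤ ‖z - 1‖ ^ 2 := norm_sub_re_le_sq hz
  have hexp : Real.exp ((k : ℝ) * (t - z.re) * Real.log (Real.log (x : ℝ))) ≤
      Real.exp ((k : ℝ) * ‖z - 1‖ ^ 2 * Real.log (Real.log (x : ℝ))) := by
    apply Real.exp_le_exp.2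
    have hk : (0 : ℝ) ≤ k := Nat.cast_nonneg k
    have := mul_le_mul_of_nonneg_left hdiff hk
    exact mul_le_mul_of_nonneg_right this hLL0
  have hP : 0 ≤ (x : ℝ) * Real.log (x : ℝ) ^ ((k : ℝ) * (z.re - 1)) :=
    mul_nonneg (by positivity) (Real.rpow_nonneg hL0.le _)
  have hA0 : A ≤ max A 0 := le_max_left _ _
  have hM0 : 0 ≤ max A 0 := le_max_right _ _
  calc ‖∑ n ∈ Finset.range (x + 1), z ^ N n‖
      ≤ ∑ n ∈ Finset.range (x + 1), t ^ N n := htri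
    _ ≤ A * (x : ℝ) * Real.log (x : ℝ) ^ ((k : ℝ) * (t - 1)) := hreal
    _ = A * ((x : ℝ) * Real.log (x : ℝ) ^ ((k : ℝ) * (z.re - 1))) *
          Real.exp ((k : ℝ) * (t - z.re) * Real.log (Real.log (x : ℝ))) := by rw [hsplit]; ring
    _ ≤ max A 0 * ((x : ℝ) * Real.log (x : ℝ) ^ ((k : ℝ) * (z.re - 1))) *
          Real.exp ((k : ℝ) * (t - z.re) * Real.log (Real.log (x : ℝ))) := by
        gcongr
    _ ≤ max A 0 * ((x : ℝ) * Real.log (x : ℝ) ^ ((k : ℝ) * (z.re - 1))) *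
          Real.exp ((k : ℝ) * ‖z - 1‖ ^ 2 * Real.log (Real.log (x : ℝ))) :=
        mul_le_mul_of_nonneg_left hexp (mul_nonneg hM0 hP)
    _ = _ := by ring

open NearCentre in
/-- **The crux VERBATIM on the shrinking disc `‖z − 1‖² log log x ≤ 1` (and `‖z − 1‖ ≤ 1/2`), for every
Bateman–Horn system**: there the loss factor of `stub_nearCentre` is `≤ e^{k}`, so `DiscMajorantLog`'s
inequality holds with budget constant `C = 0` and `A' = A e^{k}`.  The parity-free core of the near leaf;
the open content (`stub_rightOffAxis`, `stub_leftHalfDiscMajorantLog`, `stub_realAxisGrowing`) begins at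
`‖z − 1‖ ≍ (log log x)^{−1/2}`. [cite: NairTenenbaum1998, Theorem 1] -/
theorem discMajorantLog_shrinkingDisc :
    ∀ (k : ℕ) (f : Fin k → Polynomial ℤ), Literature.NumberTheory.Sieve.IsBatemanHornSystem f →
      ∃ A : ℝ, ∃ x₀ : ℕ, ∀ x : ℕ, x₀ ≤ x → ∀ z : ℂ, ‖z - 1‖ ≤ 1 / 2 →
        ‖z - 1‖ ^ 2 * Real.log (Real.log (x : ℝ)) ≤ 1 →
        ‖(∑ n ∈ Finset.range (x + 1), (z : ℂ) ^ (∑ i, (((f i).eval (n : ℤ)).toNat.factorization.sum fun _ v => min v 2)))‖ ≤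
          A * (x : ℝ) * (Real.log (x : ℝ)) ^ ((k : ℝ) * ((z : ℂ).re - 1)) := by
  intro k f hf
  obtain ⟨A, x₀, hA⟩ := stub_nearCentre k f hf
  refine ⟨max A 0 * Real.exp k, max x₀ 3, fun x hx z hz hsmall => ?_⟩
  have hx₀ : x₀ ≤ x := (le_max_left _ _).trans hx
  have hx3 : (3 : ℝ) ≤ x := by exact_mod_cast (le_max_right _ _).trans hx
  have hlogx : 1 < Real.log (x : ℝ) := by
    rw [Real.lt_log_iff_exp_lt (by linarith)]
    exact Real.exp_one_lt_d9.trans_le (by norm_num; linarith)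
  have hL0 : 0 < Real.log (x : ℝ) := by linarith
  have hP : 0 ≤ (x : ℝ) * Real.log (x : ℝ) ^ ((k : ℝ) * (z.re - 1)) :=
    mul_nonneg (by positivity) (Real.rpow_nonneg hL0.le _)
  have hk : (0 : ℝ) ≤ k := Nat.cast_nonneg k
  have hexp : Real.exp ((k : ℝ) * ‖z - 1‖ ^ 2 * Real.log (Real.log (x : ℝ))) ≤ Real.exp k := by
    apply Real.exp_le_exp.2
    have := mul_le_mul_of_nonneg_left hsmall hk
    linarith [this]
  have h := hA x hx₀ z hz
  calc ‖(∑ n ∈ Finset.range (x + 1), (z : ℂ) ^ (∑ i, (((f i).eval (n : ℤ)).toNat.factorization.sum fun _ v => min v 2)))‖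
      ≤ A * (x : ℝ) * (Real.log (x : ℝ)) ^ ((k : ℝ) * ((z : ℂ).re - 1)) *
          Real.exp ((k : ℝ) * ‖z - 1‖ ^ 2 * Real.log (Real.log (x : ℝ))) := h
    _ = A * ((x : ℝ) * (Real.log (x : ℝ)) ^ ((k : ℝ) * ((z : ℂ).re - 1))) *
          Real.exp ((k : ℝ) * ‖z - 1‖ ^ 2 * Real.log (Real.log (x : ℝ))) := by ring
    _ ≤ max A 0 * ((x : ℝ) * (Real.log (x : ℝ)) ^ ((k : ℝ) * ((z : ℂ).re - 1))) *
          Real.exp ((k : ℝ) * ‖z - 1‖ ^ 2 * Real.log (Real.log (x : ℝ))) :=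
        mul_le_mul_of_nonneg_right (mul_le_mul_of_nonneg_right (le_max_left _ _) hP)
          (Real.exp_pos _).le
    _ ≤ max A 0 * ((x : ℝ) * (Real.log (x : ℝ)) ^ ((k : ℝ) * ((z : ℂ).re - 1))) * Real.exp k :=
        mul_le_mul_of_nonneg_left hexp (mul_nonneg (le_max_right _ _) hP)
    _ = _ := by ring

end Summit.Parity.BatemanHorn.Cruxes.DiscMajorantLog.Sketch

end
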